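import Summits.CriticalPhenomena.PercolationContinuityZ3.Theorems.SahiConjecture
import Summits.CriticalPhenomena.PercolationContinuityZ3.Theorems.PercNearOneGluingNoHeavyLowerTailSahiCubeThreeAllOrdersBirkhoff
import Summits.CriticalPhenomena.PercolationContinuityZ3.Theorems.PercNearOneGluingNoHeavyLowerTailSahiWidthStratification

/-!
# `NoHeavyLowerTail` (crux stmt-CriticalPhenomena-4575), Sahi programme P1: Sahi's conjecture `C_n` ⟺ Lieb–Sahi's
# product-grid conjecture at order `n` in every dimension

Support file (Sahi cell, seat `prim-sahi-p1`, generation 3; `--supports stmt-CriticalPhenomena-4575`).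

`sahiConjecture_iff_forall_grid`: the typed obligation `SahiConjecture n` (Sahi's Conjecture 5 / Lieb–Sahi's Conjecture
1.1 at order `n`: `E_n ≥ 0` for every FKG probability weight on every finite distributive lattice) is EQUIVALENT to
`E_n ≥ 0` for every PRODUCT probability weight on every finite grid `[K+1]^d = (Fin d → Fin (K+1))`, for all `d`.
The tree already has the equivalence with product weights on CUBES `{0,1}^N` (`sahiConjecture_iff_forall_bernoulliWeight`,
Kahn's underlying-independents reduction); the present form is organised by DIMENSION: by
`SahiWidth.liebSahi_grid_iff_fkg_grid` the `d`-th conjunct alone already settles every FKG weight on every lattice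
embeddable in a `d`-dimensional grid (J-width `≤ d`), and `d ≤ 2` is proved.  Direction `⇐` embeds a finite distributive
lattice into the Boolean grid `[2]^{|J|}` (Birkhoff, `SahiCubeAllOrders.exists_birkhoff_embedding_retract`) and applies
`SahiWidth.sahiPositive_of_latticeEmbedding_grid`.  New mathematics (the organisation), standard ingredients.
-/

namespace Summit.CriticalPhenomena.PercolationContinuityZ3.Theorems.SahiWidth

open Finset Function Literature.Combinatorics.Sahi2008
open scoped BigOperators

noncomputable section

/-- **A finite power set embeds into a Boolean grid**: for a finite type `J` with `d` elements there is an injective map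
`Set J → (Fin d → Fin 2)` preserving `⊓` and `⊔` (the indicator vector). [folklore] -/
theorem exists_set_embedding_grid (J : Type*) [Fintype J] :
    ∃ F : Set J → (Fin (Fintype.card J) → Fin (1 + 1)), Function.Injective F ∧
      (∀ s t, F (s ⊓ t) = F s ⊓ F t) ∧ ∀ s t, F (s ⊔ t) = F s ⊔ F t := by
  classical
  obtain ⟨eJ, -⟩ : ∃ e : J ≃ Fin (Fintype.card J), True := ⟨Fintype.equivFin J, trivial⟩
  refine ⟨fun s i => if eJ.symm i ∈ s then 1 else 0, fun s t h => ?_, fun s t => ?_, fun s t => ?_⟩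
  · ext j
    have hj := congrFun h (eJ j)
    simp only [Equiv.symm_apply_apply] at hj
    by_cases hs : j ∈ s <;> by_cases ht : j ∈ t <;> simp_all
  · funext i
    simp only [Pi.inf_apply, Set.inf_eq_inter, Set.mem_inter_iff]
    by_cases hs : eJ.symm i ∈ s <;> by_cases ht : eJ.symm i ∈ t <;> simp [hs, ht]
  · funext i
    simp only [Pi.sup_apply, Set.sup_eq_union, Set.mem_union]
    by_cases hs : eJ.symm i ∈ s <;> by_cases ht : eJ.symm i ∈ t <;> simp [hs, ht]

/-- **Every finite distributive lattice embeds into a Boolean grid** `[2]^d`, `d` the number of join-irreducibles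
(Birkhoff's representation followed by the indicator vector): an injective map preserving `⊓` and `⊔`. [folklore] -/
theorem exists_latticeEmbedding_booleanGrid (α : Type*) [DistribLattice α] [Fintype α] [Nonempty α] :
    ∃ (d : ℕ) (e : α → (Fin d → Fin (1 + 1))), Function.Injective e ∧
      (∀ a b, e (a ⊓ b) = e a ⊓ e b) ∧ ∀ a b, e (a ⊔ b) = e a ⊔ e b := by
  classical
  obtain ⟨E, -, hEinj, hEinf, hEsup, -, -⟩ := SahiCubeAllOrders.exists_birkhoff_embedding_retract (α := α)
  obtain ⟨F, hFinj, hFinf, hFsup⟩ := exists_set_embedding_grid {j : α // SupIrred j}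
  exact ⟨_, fun a => F (E a), hFinj.comp hEinj,
    fun a b => by show F (E (a ⊓ b)) = F (E a) ⊓ F (E b); rw [hEinf, hFinf],
    fun a b => by show F (E (a ⊔ b)) = F (E a) ⊔ F (E b); rw [hEsup, hFsup]⟩

/-! ## The two proved layers: `d ≤ 2` -/

/-- **Layer `d = 1` is a theorem**: every product (= every) probability weight on the one-dimensional grid `[K+1]^1` is
Sahi-positive of every order (chains: Blinovsky's lemma, tree `sahiPositive_of_linearOrder`). [this work] -/
theorem liebSahi_grid_one (n : ℕ) :
    ∀ (K : ℕ) (g : Fin 1 → Fin (K + 1) → ℝ), (∀ i u, 0 ≤ g i u) → (∀ i, ∑ u, g i u = 1) →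
      SahiPositive (fun ω : Fin 1 → Fin (K + 1) => ∏ i, g i (ω i)) n := by
  classical
  intro K g hg0 hg1
  have hchain : SahiPositive (g 0) n := sahiPositive_of_linearOrder (hg0 0) (hg1 0) n
  have hinj : Function.Injective (fun u : Fin (K + 1) => (fun _ : Fin 1 => u)) :=
    fun u v h => congrFun h 0
  have hpush : pushWeight (g 0) (fun u : Fin (K + 1) => (fun _ : Fin 1 => u)) =
      fun ω : Fin 1 → Fin (K + 1) => ∏ i, g i (ω i) := by
    funext ω
    have hω : ω = fun _ : Fin 1 => ω 0 := funext fun i => by rw [Subsingleton.elim i 0]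
    rw [Fin.prod_univ_one, hω]
    exact pushWeight_apply_of_injective _ hinj (ω 0)
  rw [← hpush]
  exact SahiPositive.of_pushWeight hchain fun u v h _ => h

/-- **Layer `d = 2` is a theorem**: every product probability weight on the two-dimensional grid `[K+1]^2` is
Sahi-positive of every order (Lieb–Sahi's Theorem 3.7, tree `ProductChains.sahiPositive_prodWeight`). [this work] -/
theorem liebSahi_grid_two (n : ℕ) :
    ∀ (K : ℕ) (g : Fin 2 → Fin (K + 1) → ℝ), (∀ i u, 0 ≤ g i u) → (∀ i, ∑ u, g i u = 1) →
      SahiPositive (fun ω : Fin 2 → Fin (K + 1) => ∏ i, g i (ω i)) n := by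
  classical
  intro K g hg0 hg1
  have hsq := ProductChains.sahiPositive_prodWeight (g 0) (g 1) (hg0 0) (hg1 0) (hg0 1) (hg1 1) n
  have hinj : Function.Injective (fun p : Fin (K + 1) × Fin (K + 1) => ![p.1, p.2]) := by
    intro p q h
    have h0 := congrFun h 0
    have h1 := congrFun h 1
    simp only [Matrix.cons_val_zero, Matrix.cons_val_one] at h0 h1
    exact Prod.ext h0 h1
  have hmono : Monotone (fun p : Fin (K + 1) × Fin (K + 1) => ![p.1, p.2]) := by
    intro p q h i
    fin_cases i
    · exact h.1
    · exact h.2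
  have hpush : pushWeight (fun p : Fin (K + 1) × Fin (K + 1) => g 0 p.1 * g 1 p.2)
      (fun p : Fin (K + 1) × Fin (K + 1) => ![p.1, p.2]) = fun ω : Fin 2 → Fin (K + 1) => ∏ i, g i (ω i) := by
    funext ω
    have hω : ω = ![ω 0, ω 1] := funext fun i => by fin_cases i <;> rfl
    rw [Fin.prod_univ_two, hω]
    rw [pushWeight_apply_of_injective _ hinj (ω 0, ω 1)]
    simp
  rw [← hpush]
  exact SahiPositive.of_pushWeight hsq hmono

/-- Hence **every FKG probability weight on every one- or two-dimensional grid is Sahi-positive of every order**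
(generation 2's two-dimensional theorem, re-derived inside the stratification). [this work] -/
theorem sahiPositive_of_isFKGMeasure_grid_two {b : ℕ} {μ : (Fin 2 → Fin (b + 1)) → ℝ} (hμ : IsFKGMeasure μ) (n : ℕ) :
    SahiPositive μ n :=
  sahiPositive_of_isFKGMeasure_grid (liebSahi_grid_two n) hμ

/-- The one-dimensional layer, for completeness. [this work] -/
theorem sahiPositive_of_isFKGMeasure_grid_one {b : ℕ} {μ : (Fin 1 → Fin (b + 1)) → ℝ} (hμ : IsFKGMeasure μ) (n : ℕ) :
    SahiPositive μ n :=
  sahiPositive_of_isFKGMeasure_grid (liebSahi_grid_one n) hμ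

/-- **Sahi's conjecture at order `n` ⟺ Lieb–Sahi's product-grid conjecture at order `n` in all dimensions.**
`SahiConjecture n` (every FKG probability weight on every finite distributive lattice satisfies `E_n ≥ 0` for nonnegative
monotone families) holds if and only if, for every dimension `d` and side `K+1`, every PRODUCT probability weight
`⊗_i g_i` on the grid `(Fin d → Fin (K+1))` does.  (For each fixed `d` the product statement is already equivalent to the
FKG statement on all lattices of J-width `≤ d`, `liebSahi_grid_iff_fkg_grid` + `sahiPositive_of_latticeEmbedding_grid`.)
[this work] -/
theorem sahiConjecture_iff_forall_grid (n : ℕ) :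
    SahiConjecture n ↔
      ∀ (d K : ℕ) (g : Fin d → Fin (K + 1) → ℝ), (∀ i u, 0 ≤ g i u) → (∀ i, ∑ u, g i u = 1) →
        SahiPositive (fun ω : Fin d → Fin (K + 1) => ∏ i, g i (ω i)) n := by
  classical
  constructor
  · intro hC d K g hg0 hg1
    exact hC (Fin d → Fin (K + 1)) _ (isFKGMeasure_gridProd g hg0 hg1)
  · intro H α _ _ μ hμ
    have hne : Nonempty α := by
      by_contra h
      rw [not_nonempty_iff] at h
      exact one_ne_zero (hμ.sum_eq_one.symm.trans (Fintype.sum_empty _))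
    obtain ⟨d, e, he, hinf, hsup⟩ := exists_latticeEmbedding_booleanGrid α
    exact sahiPositive_of_latticeEmbedding_grid (fun K g hg0 hg1 => H d K g hg0 hg1) e he hinf hsup hμ

/-- The full hierarchy: `(∀ n, SahiConjecture n) ⟺` every product probability weight on every finite grid `[K+1]^d` is
Sahi-positive of every order. [this work] -/
theorem forall_sahiConjecture_iff_forall_grid :
    (∀ n, SahiConjecture n) ↔
      ∀ (d K : ℕ) (g : Fin d → Fin (K + 1) → ℝ), (∀ i u, 0 ≤ g i u) → (∀ i, ∑ u, g i u = 1) →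
        ∀ n, SahiPositive (fun ω : Fin d → Fin (K + 1) => ∏ i, g i (ω i)) n :=
  ⟨fun h d K g hg0 hg1 n => (sahiConjecture_iff_forall_grid n).1 (h n) d K g hg0 hg1,
    fun h n => (sahiConjecture_iff_forall_grid n).2 fun d K g hg0 hg1 => h d K g hg0 hg1 n⟩

end

end Summit.CriticalPhenomena.PercolationContinuityZ3.Theorems.SahiWidth
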